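/-
Copyright (c) 2026 the pub-hodgecm-mathlib formalisation cell (harness21).  Prover seat hodgecm-mathlib-F0P3a-p02 (g16): road «S3-ram» (LEAD F0P3a-plan (g12); architect
A-p16 (g31) 23:21:51Z deal G6-fin «AXIS BOUNDARY LAW, finite-field half»), organ A′ (ii) (a2) part (B7-iso) G6-fin, FILE 2 (the END axis vertex); 2026-09-01.
-/
import Literature.NumberTheory.Rogawski1990.DepthZeroKappaTransferTypeOneRamifiedAxisTwists   -- ★ p847236 (this seat) FILE 1; ⊇ ★ p847208∕p847196 (`card_iso_eq_sq`, `sum_ite_iso_elim_mid`), ★ p847132 (`card_filter_mul_sq_eq`), ★ `Paley.sum_quadraticChar_mul_quadraticChar_add`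
import HarnessLib

/-!
# The depth-zero κ-transfer at a tame-ramified place, type (1), ISOCELES configuration: the END-AXIS-VERTEX LAW (finite-field half, G6-fin FILE 2) — a leading form
# `Q = λ·ℓ_in² + e·x_u²` TANGENT to the conic at the inward line: `2 + χ(−λe)` null lines (`1` or `3`), and the collar class difference `= −χ(ce)` (one Jacobsthal sum)

Topic `NumberTheory/Rogawski1990`; namespace `Literature.NumberTheory.Rogawski1990`.  THEOREMS ONLY (no definition, no instance, no notation, no named fact, no `sorry`);
kernel lane `--supports stmt-HodgeConjecture-24833`.  Cell `pub/hodgecm-mathlib`, crux H413; road «S3-ram» (Literature seeding, count-neutral), P-1-ram skeleton organ A′ (ii)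
(architect A-p16 (g31)), F0P3a-p01 (g16)'s BLUEPRINT 899adc41 gap **G6 «AXIS BOUNDARY LAW» (B7-iso)**, finite-field half, FILE 2 of two (FILE 1 = ★ p847236 `…AxisTwists`: the
ROOT ∕ MIDDLE axis vertices, rank-one datum `Q = c·x_u²`).  THIS file: the END axis vertex (generation `s = (N − N₁)∕2`, where the coincident residues separate).
HONEST LABEL: HC_CM is proved only modulo the 2 remaining named inputs (hLiu418 24832, h413 24833) until rung 0 closes; finite-field algebra only — the SHAPE of the END datum
below is this seat's derivation (bus 2026-09-01T23:28:21Z) for the lattice half to confirm; the theorems hold for all parameters regardless.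

THE DATUM (derivation).  At the END vertex `M = M_W ⊕ 𝒪e_u` the `W`-block of the leading term `Ȳ_M` is the leading term of `h⁻¹(t_W − α)h`, `t_W − α = (γ − α)·E_γγ` of rank one,
so it is a RANK-ONE `h̄_W`-self-adjoint matrix `λ·v̄v̄^†`; the parent (inward axis line `P_in = 𝓀v̄_in`) is fixed, so `Q(P_in) = 0`, forcing `v̄ = v̄_in` ISOTROPIC.  Hence on the
conic `C_d : d₀x_α² + d₁x_u² + d₂x_γ² = 0` of an axis literal (`−d₀∕d₂ = ρ₀²`, `v̄_in = (1, 0, ρ₀)`, `ℓ_in(x̄) := h̄(x̄, v̄_in) = d₀x_α + d₂ρ₀x_γ`):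
  **`Q_END(x̄) = λ·ℓ_in(x̄)² + e·x_u²`**   (`λ, e ≠ 0`; class read as `χ(c·Q)`).
THE MATHEMATICS (vector currency `v ∈ k³ = k × k × k`, each line `q − 1` times).  In the coordinates `u = x_γ − ρ₀x_α`, `w = x_γ + ρ₀x_α` (`2ρ₀ ≠ 0`):
`d₀x_α² + d₂x_γ² = d₂uw`, `ℓ_in = d₂ρ₀u`, and ON the conic `e·x_u² = −(e∕d₁)·d₂uw`, so `Q ≡ d₂u·(λd₂ρ₀²·u − (e∕d₁)·w)` — the conic is TANGENT to `{Q = 0}` at `P_in` (`u = 0`).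
Eliminating `x_u` (★ `sum_ite_iso_elim_mid`: weight `χ(−d₁d₂uw) + 1`):
* NULL vectors: `u = 0` (the inward LINE, `q` vectors with `0`) or `w = (λd₁d₂ρ₀²∕e)u`, `u ≠ 0` (weight `χ(−λe) + 1`): **`#{iso ∧ Q = 0} = q + (q−1)(χ(−λe) + 1)`** —
  in line currency `2 + χ(−λe) ∈ {1, 3}`: the inward line plus TWO `E`-lines for the literal with `χ(−λe) = 1` (the «big» literal), none for the other (`card_isoEndNull_eq`);
* CLASS DIFFERENCE: `J := Σ_{v iso} χ(cQ) = Σ_{u≠0} χ(−cd₁)·Σ_w χ(w(Au − Bw)) + Σ_u χ(cd₂u)Σ_w χ(Au − Bw) = (q−1)χ(−cd₁)·(−χ(−B)) + 0 =` **`−(q−1)·χ(ce)`** — ONE Jacobsthal sum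
  `Σ_w χ(w)χ(w + a) = −1` (★ `Paley.sum_quadraticChar_mul_quadraticChar_add`), INDEPENDENT of `λ`, `ρ₀`, `d₀`, `d₂` (`rootEndClassSum_eq`);
* CLASS COUNTS: `2·#{iso ∧ χ(cQ) = σ} = (q−1)·(q − 1 − χ(−λe) − σχ(ce))` (`two_mul_card_isoEndClass_eq`), and for the PAIR of axis literals (same `d₁, ρ₀, e, c`; `λ, λ′` with
  `χ(−λe) + χ(−λ′e) = 0`, one big one not): `#_σ + #′_σ = (q−1)·(q − 1 − σχ(ce))` (`card_isoEndClass_add_eq_of_opposite`).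
KILL-CHECKS (A-p16 (g31) census row 23:19:27Z, lines × `q` lifts): END vertex, BIG literal: 2 `E`-lines + `(q−2)` collar split [q=3: 0⁺ 1⁻; q=5: 2⁺ 1⁻]; OTHER `b_u = 0` literal: 0 + `q`
collar [q=3: 1⁺ 2⁻; q=5: 3⁺ 2⁻] — i.e. null `3 ∕ 1` ✓ (`2 + χ(−λe)`), collar `q − 1 − χ(−λe)` ✓, class difference `−1 ∕ +1` at `q = 3 ∕ 5` for BOTH literals ✓ (`−χ(ce)`, literal-free);
numerics (this seat) exhaustive over random `(d, ρ₀, λ, e, c)` for `q ≤ 13` ✓.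

* §0 generic: `sum_ite_quadraticChar_eq_card_sub_card`, `card_filter_eq_card_add_card_add_card_quadraticChar`, `two_mul_card_filter_quadraticChar_eq` (any `Fintype`, any `f`);
  `sum_quadraticChar_sub_mul_eq_zero` (`Σ_w χ(A − Bw) = 0`), `sum_quadraticChar_mul_sub_mul` (`Σ_w χ(w(A − Bw)) = −χ(−B)`, `A, B ≠ 0`).
* §1 `card_isoEndNull_eq`, `rootEndClassSum_eq`, `two_mul_card_isoEndClass_eq`; §2 `card_isoEndClass_add_eq_of_opposite`.

## References
* [Rogawski1990] J. D. Rogawski, *Automorphic Representations of Unitary Groups in Three Variables*, Ann. of Math. Stud. 123 (1990), §4.9 Prop. 4.9.1 (a)(b) p. 55; §12.2.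
* [LabesseLanglands1979] J.-P. Labesse, R. P. Langlands, *L-indistinguishability for SL(2)*, Canad. J. Math. 31 (1979), §5 (κ-signs over the four classes).
* [IrelandRosen1990] K. Ireland, M. Rosen, *A Classical Introduction to Modern Number Theory*, GTM 84, Ch. 8 §1–§2 (quadratic character sums, Jacobsthal sums).
-/

set_option autoImplicit false

namespace Literature.NumberTheory.Rogawski1990

open Finset

variable {k : Type*} [Field k] [Fintype k] [DecidableEq k]

/-! ## §0 Generic counting through the quadratic character, and two affine character sums -/

section Generic

variable {α : Type*} [Fintype α] (P : α → Prop) [DecidablePred P] (f : α → k)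

/-- `Σ_{a : P a} χ(f a) = #{P ∧ χ f = 1} − #{P ∧ χ f = −1}` (`χ` takes values `0, ±1`). [cite: IrelandRosen1990, Ch. 8 §1] -/
theorem sum_ite_quadraticChar_eq_card_sub_card :
    (∑ a, if P a then quadraticChar k (f a) else 0) =
      ((univ.filter fun a => P a ∧ quadraticChar k (f a) = 1).card : ℤ) - ((univ.filter fun a => P a ∧ quadraticChar k (f a) = -1).card : ℤ) := by
  rw [natCast_card_filter, natCast_card_filter, ← Finset.sum_sub_distrib]
  refine Finset.sum_congr rfl fun a _ => ?_
  by_cases h : P a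
  · simp only [h, true_and, if_true]
    rcases eq_or_ne (f a) 0 with h0 | h0
    · rw [h0, MulChar.map_zero]; norm_num
    · rcases quadraticChar_dichotomy h0 with h1 | h1 <;> rw [h1] <;> norm_num
  · simp only [h, false_and, if_false, sub_zero]

/-- `#{P} = #{P ∧ χ f = 1} + #{P ∧ χ f = −1} + #{P ∧ f = 0}`. [cite: IrelandRosen1990, Ch. 8 §1] -/
theorem card_filter_eq_card_add_card_add_card_quadraticChar :
    ((univ.filter fun a => P a).card : ℤ) =
      ((univ.filter fun a => P a ∧ quadraticChar k (f a) = 1).card : ℤ) + ((univ.filter fun a => P a ∧ quadraticChar k (f a) = -1).card : ℤ) +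
        ((univ.filter fun a => P a ∧ f a = 0).card : ℤ) := by
  rw [natCast_card_filter, natCast_card_filter, natCast_card_filter, natCast_card_filter, ← Finset.sum_add_distrib, ← Finset.sum_add_distrib]
  refine Finset.sum_congr rfl fun a _ => ?_
  by_cases h : P a
  · simp only [h, true_and, if_true]
    rcases eq_or_ne (f a) 0 with h0 | h0
    · rw [h0, MulChar.map_zero]; norm_num
    · rcases quadraticChar_dichotomy h0 with h1 | h1 <;> rw [h1] <;> simp [h0]
  · simp only [h, false_and, if_false, add_zero]

/-- **`2·#{P ∧ χ f = σ} = #{P} − #{P ∧ f = 0} + σ·Σ_{P} χ f`** for `σ = ±1`. [cite: IrelandRosen1990, Ch. 8 §1] -/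
theorem two_mul_card_filter_quadraticChar_eq {σ : ℤ} (hσ : σ = 1 ∨ σ = -1) :
    2 * ((univ.filter fun a => P a ∧ quadraticChar k (f a) = σ).card : ℤ) =
      ((univ.filter fun a => P a).card : ℤ) - ((univ.filter fun a => P a ∧ f a = 0).card : ℤ) + σ * ∑ a, if P a then quadraticChar k (f a) else 0 := by
  have hP := card_filter_eq_card_add_card_add_card_quadraticChar (k := k) P f
  have hJ := sum_ite_quadraticChar_eq_card_sub_card (k := k) P f
  rcases hσ with rfl | rfl
  · rw [one_mul, hJ]; linear_combination (-1 : ℤ) * hP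
  · rw [neg_one_mul, hJ]; linear_combination (-1 : ℤ) * hP

end Generic

/-- `Σ_w χ(A − B·w) = 0` for `B ≠ 0` (an affine substitution of ★ `quadraticChar_sum_zero`). [cite: IrelandRosen1990, Ch. 8 §1] -/
theorem sum_quadraticChar_sub_mul_eq_zero (hk : ringChar k ≠ 2) (A : k) {B : k} (hB : B ≠ 0) : ∑ w : k, quadraticChar k (A - B * w) = 0 := by
  rw [← quadraticChar_sum_zero hk]
  refine Fintype.sum_equiv ⟨fun w => A - B * w, fun t => (A - t) / B, fun w => ?_, fun t => ?_⟩ _ _ fun _ => rfl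
  · field_simp; ring
  · field_simp; ring

/-- **`Σ_w χ(w·(A − B·w)) = −χ(−B)`** for `A, B ≠ 0` (`= χ(−B)·Σ_w χ(w)χ(w − A∕B)`, Jacobsthal ★ `Paley.sum_quadraticChar_mul_quadraticChar_add`). [cite: IrelandRosen1990, Ch. 8 §2] -/
theorem sum_quadraticChar_mul_sub_mul (hk : ringChar k ≠ 2) {A B : k} (hA : A ≠ 0) (hB : B ≠ 0) :
    ∑ w : k, quadraticChar k (w * (A - B * w)) = -quadraticChar k (-B) := by
  have hrw : ∀ w : k, w * (A - B * w) = -B * (w * (w + -(A / B))) := fun w => by field_simp; ring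
  simp_rw [hrw, map_mul (quadraticChar k) (-B)]
  rw [← Finset.mul_sum]
  simp_rw [map_mul]
  rw [Literature.Combinatorics.Designs.Paley.sum_quadraticChar_mul_quadraticChar_add hk (neg_ne_zero.2 (div_ne_zero hA hB)), mul_neg, mul_one]

/-! ## §1 One axis literal at the END vertex: `Q = λ·(d₀x_α + d₂ρ₀x_γ)² + e·x_u²`, `d₀ = −d₂ρ₀²` -/

section EndVertex

variable {d₀ d₁ d₂ ρ₀ l e c : k}

omit [Fintype k] [DecidableEq k] in
/-- The coordinate change `(x_α, x_γ) ↦ (u, w) = (x_γ − ρ₀x_α, x_γ + ρ₀x_α)` as an equivalence of `k × k` (`2ρ₀ ≠ 0`). [cite: IrelandRosen1990, Ch. 8 §2] -/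
private theorem exists_equiv_uw (hk : ringChar k ≠ 2) (hρ : ρ₀ ≠ 0) :
    ∃ σ : k × k ≃ k × k, ∀ p : k × k, σ p = (p.2 - ρ₀ * p.1, p.2 + ρ₀ * p.1) := by
  have h2 : (2 : k) ≠ 0 := Ring.two_ne_zero hk
  refine ⟨⟨fun p => (p.2 - ρ₀ * p.1, p.2 + ρ₀ * p.1), fun p => ((p.2 - p.1) / (2 * ρ₀), (p.1 + p.2) / 2), fun p => ?_, fun p => ?_⟩, fun p => rfl⟩
  · ext <;> field_simp <;> ring
  · ext <;> field_simp <;> ring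

/-- **NULL VECTORS AT THE END VERTEX: `#{v : iso ∧ Q(v) = 0} = q + (q−1)·(χ(−λe) + 1)`** — the inward line (`u = 0`) and, iff `χ(−λe) = 1`, two more lines (`w = (λd₁d₂ρ₀²∕e)·u`);
in line currency `2 + χ(−λe) ∈ {1, 3}` (the conic is TANGENT to `{Q = 0}` at the inward point). [cite: Rogawski1990, §4.9 Prop. 4.9.1 (b) p. 55] [cite: IrelandRosen1990, Ch. 8 §2] -/
theorem card_isoEndNull_eq (hk : ringChar k ≠ 2) (hd₁ : d₁ ≠ 0) (hd₂ : d₂ ≠ 0) (hρ : ρ₀ ≠ 0) (hd₀ : d₀ = -(d₂ * ρ₀ ^ 2)) (hl : l ≠ 0) (he : e ≠ 0) :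
    ((univ.filter fun v : k × k × k => d₀ * v.1 ^ 2 + d₁ * v.2.1 ^ 2 + d₂ * v.2.2 ^ 2 = 0 ∧
        l * (d₀ * v.1 + d₂ * ρ₀ * v.2.2) ^ 2 + e * v.2.1 ^ 2 = 0).card : ℤ) =
      (Fintype.card k : ℤ) + ((Fintype.card k : ℤ) - 1) * (quadraticChar k (-(l * e)) + 1) := by
  rw [natCast_card_filter]
  -- on the conic, `e·x_u² = −(e∕d₁)(d₀x² + d₂z²)`
  have hcongr : ∀ v : k × k × k, (if d₀ * v.1 ^ 2 + d₁ * v.2.1 ^ 2 + d₂ * v.2.2 ^ 2 = 0 ∧ l * (d₀ * v.1 + d₂ * ρ₀ * v.2.2) ^ 2 + e * v.2.1 ^ 2 = 0 then (1 : ℤ) else 0) =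
      if d₀ * v.1 ^ 2 + d₁ * v.2.1 ^ 2 + d₂ * v.2.2 ^ 2 = 0 then
        (if l * (d₀ * v.1 + d₂ * ρ₀ * v.2.2) ^ 2 - e / d₁ * (d₀ * v.1 ^ 2 + d₂ * v.2.2 ^ 2) = 0 then 1 else 0) else 0 := by
    intro v
    by_cases h : d₀ * v.1 ^ 2 + d₁ * v.2.1 ^ 2 + d₂ * v.2.2 ^ 2 = 0
    · have hy' : v.2.1 ^ 2 = -(d₀ * v.1 ^ 2 + d₂ * v.2.2 ^ 2) / d₁ := by
        rw [eq_div_iff hd₁]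
        linear_combination h
      have hy : e * v.2.1 ^ 2 = -(e / d₁ * (d₀ * v.1 ^ 2 + d₂ * v.2.2 ^ 2)) := by
        rw [hy']
        ring
      simp only [h, true_and, if_true, hy, ← sub_eq_add_neg]
    · simp only [h, false_and, if_false]
  simp_rw [hcongr]
  rw [sum_ite_iso_elim_mid hk hd₁ (fun x z => if l * (d₀ * x + d₂ * ρ₀ * z) ^ 2 - e / d₁ * (d₀ * x ^ 2 + d₂ * z ^ 2) = 0 then (1 : ℤ) else 0)]
  -- change variables `(x,z) ↦ (u,w)`
  obtain ⟨σ, hσ⟩ := exists_equiv_uw hk hρ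
  have hsub : ∀ p : k × k, (quadraticChar k (-(d₁ * (d₀ * p.1 ^ 2 + d₂ * p.2 ^ 2))) + 1) *
        (if l * (d₀ * p.1 + d₂ * ρ₀ * p.2) ^ 2 - e / d₁ * (d₀ * p.1 ^ 2 + d₂ * p.2 ^ 2) = 0 then (1 : ℤ) else 0) =
      (fun uw : k × k => (quadraticChar k (-(d₁ * d₂ * uw.1 * uw.2)) + 1) *
        (if d₂ * uw.1 * (l * d₂ * ρ₀ ^ 2 * uw.1 - e / d₁ * uw.2) = 0 then (1 : ℤ) else 0)) (σ p) := by
    intro p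
    rw [hσ p]
    have h1 : -(d₁ * (d₀ * p.1 ^ 2 + d₂ * p.2 ^ 2)) = -(d₁ * d₂ * (p.2 - ρ₀ * p.1) * (p.2 + ρ₀ * p.1)) := by rw [hd₀]; ring
    have h2 : l * (d₀ * p.1 + d₂ * ρ₀ * p.2) ^ 2 - e / d₁ * (d₀ * p.1 ^ 2 + d₂ * p.2 ^ 2) =
        d₂ * (p.2 - ρ₀ * p.1) * (l * d₂ * ρ₀ ^ 2 * (p.2 - ρ₀ * p.1) - e / d₁ * (p.2 + ρ₀ * p.1)) := by rw [hd₀]; ring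
    simp only [h1, h2]
  rw [Fintype.sum_equiv σ _ (fun uw : k × k => (quadraticChar k (-(d₁ * d₂ * uw.1 * uw.2)) + 1) *
        (if d₂ * uw.1 * (l * d₂ * ρ₀ ^ 2 * uw.1 - e / d₁ * uw.2) = 0 then (1 : ℤ) else 0)) hsub, Fintype.sum_prod_type]
  -- `u = 0`: every `w` contributes `1`; `u ≠ 0`: exactly `w = (l d₁ d₂ ρ₀² ∕ e)·u` contributes `χ(−λe) + 1`
  rw [Fintype.sum_eq_add_sum_compl (0 : k)]
  have h0 : ∑ w : k, (quadraticChar k (-(d₁ * d₂ * 0 * w)) + 1) * (if d₂ * 0 * (l * d₂ * ρ₀ ^ 2 * 0 - e / d₁ * w) = 0 then (1 : ℤ) else 0) =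
      (Fintype.card k : ℤ) := by
    simp only [mul_zero, zero_mul, neg_zero, MulChar.map_zero, zero_add, if_true, Finset.sum_const, Finset.card_univ, nsmul_eq_mul, mul_one]
  rw [h0]
  have hB : e / d₁ ≠ 0 := div_ne_zero he hd₁
  have hrest : ∀ u ∈ ({(0 : k)}ᶜ : Finset k), ∑ w : k, (quadraticChar k (-(d₁ * d₂ * u * w)) + 1) *
      (if d₂ * u * (l * d₂ * ρ₀ ^ 2 * u - e / d₁ * w) = 0 then (1 : ℤ) else 0) = quadraticChar k (-(l * e)) + 1 := by
    intro u hu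
    rw [Finset.mem_compl, Finset.mem_singleton] at hu
    -- the unique `w₀ = (λd₂ρ₀²u) ∕ (e∕d₁)`
    rw [Finset.sum_eq_single (l * d₂ * ρ₀ ^ 2 * u / (e / d₁))]
    · have hw0 : d₂ * u * (l * d₂ * ρ₀ ^ 2 * u - e / d₁ * (l * d₂ * ρ₀ ^ 2 * u / (e / d₁))) = 0 := by
        rw [mul_div_cancel₀ _ hB, sub_self, mul_zero]
      rw [if_pos hw0, mul_one]
      have hval : -(d₁ * d₂ * u * (l * d₂ * ρ₀ ^ 2 * u / (e / d₁))) = -(l * e) * (d₁ * d₂ * ρ₀ * u / e) ^ 2 := by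
        field_simp
      rw [hval, map_mul, map_pow, quadraticChar_sq_one (div_ne_zero (mul_ne_zero (mul_ne_zero (mul_ne_zero hd₁ hd₂) hρ) hu) he), mul_one]
    · intro w _ hw
      rw [if_neg, mul_zero]
      intro h0
      apply hw
      have h' : l * d₂ * ρ₀ ^ 2 * u - e / d₁ * w = 0 := by
        rcases mul_eq_zero.1 h0 with h1 | h1
        · exact absurd h1 (mul_ne_zero hd₂ hu)
        · exact h1
      rw [eq_div_iff hB]
      linear_combination (-1 : k) * h'
    · intro h
      exact absurd (Finset.mem_univ _) h
  rw [Finset.sum_congr rfl hrest, Finset.sum_const, Finset.card_compl, Finset.card_singleton, nsmul_eq_mul,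
    Nat.cast_sub Fintype.card_pos, Nat.cast_one]

/-- **THE CLASS SUM AT THE END VERTEX: `Σ_{v iso} χ(c·Q(v)) = −(q−1)·χ(ce)`** — independent of `λ, ρ₀, d₀, d₂`: in the `(u,w)` coordinates `cQ ≡ c·d₂u·(Au − Bw)`
(`A = λd₂ρ₀²`, `B = e∕d₁`), the weight-`1` part is `Σ_u χ(cd₂u)·Σ_w χ(Au − Bw) = 0` and the weight-`χ` part is `Σ_{u≠0} χ(−cd₁)·Σ_w χ(w(Au − Bw)) = −(q−1)χ(−cd₁)χ(−B)`.
[cite: Rogawski1990, §4.9 Prop. 4.9.1 (b) p. 55] [cite: IrelandRosen1990, Ch. 8 §2] -/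
theorem rootEndClassSum_eq (hk : ringChar k ≠ 2) (hd₁ : d₁ ≠ 0) (hd₂ : d₂ ≠ 0) (hρ : ρ₀ ≠ 0) (hd₀ : d₀ = -(d₂ * ρ₀ ^ 2)) (hl : l ≠ 0) (he : e ≠ 0) (hc : c ≠ 0) :
    (∑ v : k × k × k, if d₀ * v.1 ^ 2 + d₁ * v.2.1 ^ 2 + d₂ * v.2.2 ^ 2 = 0 then
        quadraticChar k (c * (l * (d₀ * v.1 + d₂ * ρ₀ * v.2.2) ^ 2 + e * v.2.1 ^ 2)) else 0) =
      -(((Fintype.card k : ℤ) - 1) * quadraticChar k (c * e)) := by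
  have hcongr : ∀ v : k × k × k, (if d₀ * v.1 ^ 2 + d₁ * v.2.1 ^ 2 + d₂ * v.2.2 ^ 2 = 0 then
        quadraticChar k (c * (l * (d₀ * v.1 + d₂ * ρ₀ * v.2.2) ^ 2 + e * v.2.1 ^ 2)) else 0) =
      if d₀ * v.1 ^ 2 + d₁ * v.2.1 ^ 2 + d₂ * v.2.2 ^ 2 = 0 then
        quadraticChar k (c * (l * (d₀ * v.1 + d₂ * ρ₀ * v.2.2) ^ 2 - e / d₁ * (d₀ * v.1 ^ 2 + d₂ * v.2.2 ^ 2))) else 0 := by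
    intro v
    by_cases h : d₀ * v.1 ^ 2 + d₁ * v.2.1 ^ 2 + d₂ * v.2.2 ^ 2 = 0
    · have hy' : v.2.1 ^ 2 = -(d₀ * v.1 ^ 2 + d₂ * v.2.2 ^ 2) / d₁ := by
        rw [eq_div_iff hd₁]
        linear_combination h
      have hy : e * v.2.1 ^ 2 = -(e / d₁ * (d₀ * v.1 ^ 2 + d₂ * v.2.2 ^ 2)) := by
        rw [hy']
        ring
      simp only [h, if_true, hy, ← sub_eq_add_neg]
    · simp only [h, if_false]
  simp_rw [hcongr]
  rw [sum_ite_iso_elim_mid hk hd₁ (fun x z => quadraticChar k (c * (l * (d₀ * x + d₂ * ρ₀ * z) ^ 2 - e / d₁ * (d₀ * x ^ 2 + d₂ * z ^ 2))))]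
  obtain ⟨σ, hσ⟩ := exists_equiv_uw hk hρ
  have hsub : ∀ p : k × k, (quadraticChar k (-(d₁ * (d₀ * p.1 ^ 2 + d₂ * p.2 ^ 2))) + 1) *
        quadraticChar k (c * (l * (d₀ * p.1 + d₂ * ρ₀ * p.2) ^ 2 - e / d₁ * (d₀ * p.1 ^ 2 + d₂ * p.2 ^ 2))) =
      (fun uw : k × k => (quadraticChar k (-(d₁ * d₂ * uw.1 * uw.2)) + 1) *
        quadraticChar k (c * (d₂ * uw.1) * (l * d₂ * ρ₀ ^ 2 * uw.1 - e / d₁ * uw.2))) (σ p) := by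
    intro p
    rw [hσ p]
    have h1 : -(d₁ * (d₀ * p.1 ^ 2 + d₂ * p.2 ^ 2)) = -(d₁ * d₂ * (p.2 - ρ₀ * p.1) * (p.2 + ρ₀ * p.1)) := by rw [hd₀]; ring
    have h2 : c * (l * (d₀ * p.1 + d₂ * ρ₀ * p.2) ^ 2 - e / d₁ * (d₀ * p.1 ^ 2 + d₂ * p.2 ^ 2)) =
        c * (d₂ * (p.2 - ρ₀ * p.1)) * (l * d₂ * ρ₀ ^ 2 * (p.2 - ρ₀ * p.1) - e / d₁ * (p.2 + ρ₀ * p.1)) := by rw [hd₀]; ring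
    simp only [h1, h2]
  rw [Fintype.sum_equiv σ _ (fun uw : k × k => (quadraticChar k (-(d₁ * d₂ * uw.1 * uw.2)) + 1) *
        quadraticChar k (c * (d₂ * uw.1) * (l * d₂ * ρ₀ ^ 2 * uw.1 - e / d₁ * uw.2))) hsub, Fintype.sum_prod_type]
  -- per `u`: `Σ_w (χ(−d₁d₂uw) + 1)·χ(c d₂ u (Au − Bw)) = [u ≠ 0]·(−χ(ce))`
  have hB : e / d₁ ≠ 0 := div_ne_zero he hd₁
  have hu : ∀ u : k, ∑ w : k, (quadraticChar k (-(d₁ * d₂ * u * w)) + 1) * quadraticChar k (c * (d₂ * u) * (l * d₂ * ρ₀ ^ 2 * u - e / d₁ * w)) =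
      if u = 0 then 0 else -quadraticChar k (c * e) := by
    intro u
    by_cases hu0 : u = 0
    · simp [hu0]
    rw [if_neg hu0]
    simp_rw [add_mul, one_mul, Finset.sum_add_distrib]
    -- weight-one part vanishes
    have hz : ∑ w : k, quadraticChar k (c * (d₂ * u) * (l * d₂ * ρ₀ ^ 2 * u - e / d₁ * w)) = 0 := by
      simp_rw [map_mul (quadraticChar k) (c * (d₂ * u))]
      rw [← Finset.mul_sum, sum_quadraticChar_sub_mul_eq_zero hk _ hB, mul_zero]
    -- weight-χ part: `χ(−d₁d₂uw)·χ(cd₂u(Au − Bw)) = χ(−cd₁·(d₂u)²)·χ(w(Au − Bw))`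
    have hχ : ∀ w : k, quadraticChar k (-(d₁ * d₂ * u * w)) * quadraticChar k (c * (d₂ * u) * (l * d₂ * ρ₀ ^ 2 * u - e / d₁ * w)) =
        quadraticChar k (-(c * d₁) * (d₂ * u) ^ 2) * quadraticChar k (w * (l * d₂ * ρ₀ ^ 2 * u - e / d₁ * w)) := by
      intro w
      rw [← map_mul, ← map_mul]
      congr 1
      ring
    simp_rw [hχ]
    rw [← Finset.mul_sum, sum_quadraticChar_mul_sub_mul hk (mul_ne_zero (mul_ne_zero (mul_ne_zero hl hd₂) (pow_ne_zero _ hρ)) hu0) hB, hz, add_zero,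
      map_mul, map_pow, quadraticChar_sq_one (mul_ne_zero hd₂ hu0), mul_one]
    have hce : quadraticChar k (-(c * d₁)) * quadraticChar k (-(e / d₁)) = quadraticChar k (c * e) := by
      rw [← map_mul]
      congr 1
      field_simp
    rw [mul_neg, hce]
  simp_rw [hu]
  rw [Finset.sum_ite, Finset.sum_const_zero, zero_add, Finset.sum_const, Finset.filter_ne', Finset.card_erase_of_mem (Finset.mem_univ _), Finset.card_univ,
    smul_neg, nsmul_eq_mul, Nat.cast_sub Fintype.card_pos, Nat.cast_one]

/-- **CLASS VECTORS AT THE END VERTEX: `2·#{v : iso ∧ χ(cQ) = σ} = (q−1)·(q − 1 − χ(−λe) − σ·χ(ce))`** (`σ = ±1`; line currency: `(q − 1 − χ(−λe) − σχ(ce))∕2`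
collar lines of class `σ`, total collar `q − 1 − χ(−λe)`, difference `−χ(ce)`). [cite: Rogawski1990, §4.9 Prop. 4.9.1 (b) p. 55; §12.2] [cite: LabesseLanglands1979, §5] -/
theorem two_mul_card_isoEndClass_eq (hk : ringChar k ≠ 2) (hd₁ : d₁ ≠ 0) (hd₂ : d₂ ≠ 0) (hρ : ρ₀ ≠ 0) (hd₀ : d₀ = -(d₂ * ρ₀ ^ 2)) (hl : l ≠ 0) (he : e ≠ 0)
    (hc : c ≠ 0) {σ : ℤ} (hσ : σ = 1 ∨ σ = -1) :
    2 * ((univ.filter fun v : k × k × k => d₀ * v.1 ^ 2 + d₁ * v.2.1 ^ 2 + d₂ * v.2.2 ^ 2 = 0 ∧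
        quadraticChar k (c * (l * (d₀ * v.1 + d₂ * ρ₀ * v.2.2) ^ 2 + e * v.2.1 ^ 2)) = σ).card : ℤ) =
      ((Fintype.card k : ℤ) - 1) * ((Fintype.card k : ℤ) - 1 - quadraticChar k (-(l * e)) - σ * quadraticChar k (c * e)) := by
  have hd₀0 : d₀ ≠ 0 := by rw [hd₀]; exact neg_ne_zero.2 (mul_ne_zero hd₂ (pow_ne_zero _ hρ))
  rw [two_mul_card_filter_quadraticChar_eq (fun v : k × k × k => d₀ * v.1 ^ 2 + d₁ * v.2.1 ^ 2 + d₂ * v.2.2 ^ 2 = 0)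
      (fun v : k × k × k => c * (l * (d₀ * v.1 + d₂ * ρ₀ * v.2.2) ^ 2 + e * v.2.1 ^ 2)) hσ,
    card_iso_eq_sq hk hd₀0 hd₁ hd₂, rootEndClassSum_eq hk hd₁ hd₂ hρ hd₀ hl he hc]
  have hnull : ((univ.filter fun v : k × k × k => d₀ * v.1 ^ 2 + d₁ * v.2.1 ^ 2 + d₂ * v.2.2 ^ 2 = 0 ∧
        c * (l * (d₀ * v.1 + d₂ * ρ₀ * v.2.2) ^ 2 + e * v.2.1 ^ 2) = 0).card : ℤ) =
      (Fintype.card k : ℤ) + ((Fintype.card k : ℤ) - 1) * (quadraticChar k (-(l * e)) + 1) := by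
    rw [← card_isoEndNull_eq hk hd₁ hd₂ hρ hd₀ hl he]
    congr 2
    refine Finset.filter_congr fun v _ => ?_
    simp only [mul_eq_zero, hc, false_or]
  rw [hnull]
  ring

end EndVertex

/-! ## §2 The two axis literals at the END vertex: one «big» (`χ(−λe) = 1`), one not -/

section Pair

variable {d₀ d₁ d₂ ρ₀ l l' e c : k}

/-- **THE PAIR OF AXIS LITERALS AT THE END VERTEX** (same `d₁, ρ₀, e, c`; `W`-scales `λ, λ′` with OPPOSITE `χ(−λe) + χ(−λ′e) = 0` — one literal «big», one not):
`#_σ + #′_σ = (q−1)·(q − 1 − σχ(ce))` class-`σ` vectors (line currency `q − 1 − σχ(ce)`: A-p16's `[0⁺+1⁺, 1⁻+2⁻]` at `q = 3` and `[2⁺+3⁺, 1⁻+2⁻]` at `q = 5`).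
[cite: Rogawski1990, §4.9 Prop. 4.9.1 (b) p. 55; §12.2] [cite: LabesseLanglands1979, §5] -/
theorem card_isoEndClass_add_eq_of_opposite (hk : ringChar k ≠ 2) (hd₁ : d₁ ≠ 0) (hd₂ : d₂ ≠ 0) (hρ : ρ₀ ≠ 0) (hd₀ : d₀ = -(d₂ * ρ₀ ^ 2))
    (hl : l ≠ 0) (hl' : l' ≠ 0) (he : e ≠ 0) (hc : c ≠ 0) (hopp : quadraticChar k (-(l * e)) + quadraticChar k (-(l' * e)) = 0) {σ : ℤ} (hσ : σ = 1 ∨ σ = -1) :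
    ((univ.filter fun v : k × k × k => d₀ * v.1 ^ 2 + d₁ * v.2.1 ^ 2 + d₂ * v.2.2 ^ 2 = 0 ∧
        quadraticChar k (c * (l * (d₀ * v.1 + d₂ * ρ₀ * v.2.2) ^ 2 + e * v.2.1 ^ 2)) = σ).card : ℤ) +
      ((univ.filter fun v : k × k × k => d₀ * v.1 ^ 2 + d₁ * v.2.1 ^ 2 + d₂ * v.2.2 ^ 2 = 0 ∧
        quadraticChar k (c * (l' * (d₀ * v.1 + d₂ * ρ₀ * v.2.2) ^ 2 + e * v.2.1 ^ 2)) = σ).card : ℤ) =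
      ((Fintype.card k : ℤ) - 1) * ((Fintype.card k : ℤ) - 1 - σ * quadraticChar k (c * e)) := by
  have h1 := two_mul_card_isoEndClass_eq hk hd₁ hd₂ hρ hd₀ hl he hc hσ
  have h2 := two_mul_card_isoEndClass_eq hk hd₁ hd₂ hρ hd₀ hl' he hc hσ
  refine mul_left_cancel₀ (two_ne_zero : (2 : ℤ) ≠ 0) ?_
  linear_combination h1 + h2 - ((Fintype.card k : ℤ) - 1) * hopp

end Pair

end Literature.NumberTheory.Rogawski1990
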